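import Summits.AtomisticToContinuum.FouriersLaw.Theses.VanishingNoiseTransfer
import Literature.MathematicalPhysics.KineticTheory.VelocityFlipNoise
import Literature.MathematicalPhysics.KineticTheory.MomentumHermiteLadder

/-!
# Line `half-conserved-witness` — crux `VanishingNoiseTransfer.NoisyFourier` (stmt-AtomisticToContinuum-11977)

Skeleton (crux-plan, round 1) of idea card `half-conserved-witness` (ideator 1; triage r1: pass ×3, merge
≈ `cell-parity-thomson-witness`). The crux is `FlipFouriersLawFor (pinnedChain ω₂ lam β γ) ε` for all
parameters `> 0` and EVERY flip rate `ε > 0` (`noisyFourier_iff` below): (i) the weak steady state of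
`L + εS` exists and is unique; (ii) the finite-`N` responses `D_N(ε)` exist and converge to `κ_ε(T) > 0`.

THE LEVER (positivity half of (ii), unprinted for flip-only noise — BernardinOlla2011 §6.2 p.14): at
equilibrium `T` the open-chain Kubo identity `(N−1) T² D_N(ε) = σ_N := ⟨J_N, (−L_{N,ε})⁻¹ J_N⟩_{L²(Gibbs)}`
and the resolvent variational (Thomson) principle give, for EVERY tempered test function `w`,
`(∫ w J_N dG)² ≤ (N−1) T² D_N(ε) · (‖w‖₁² + ‖L_H w‖₋₁²)`, `‖w‖₁² = ε·flipForm(w) + γT·bathForm(w)`.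
Flips make the `(−1)`-cost FINITE exactly when the Liouville image `L_H w` has no component in
`ker K = {even in every momentum} ∩ {independent of the bath momenta p_0, p_{N−1}}` ("half-conserved":
`Π₀(L_H w) = 0`; the averaging over `p_0, p_{N−1}` is the contact rule of triage — the bath cells absorb
all-even data of zero conditional mean), and then coercivity of `K = εS + γ(B_0+B_{N−1})` on `(ker K)^⊥`
(`−K ≥ 2 min(ε,γ)`: BernardinOlla2011 Lemma 2 + the Ornstein–Uhlenbeck gap) bounds it by
`‖L_H w‖²_{L²}/(2 min(ε,γ))`. ONE ε-INDEPENDENT admissible family `(w_N)_N` with extensive pairing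
`∫ w_N J_N ≥ c₁(N−1)` and extensive coarse costs therefore floors `D_N(ε)` for ALL `ε > 0` at once:
`D_N(ε) ≥ c₁² / (T² c₂ (ε + γT + 1/(2 min(ε,γ))))`. Harmonic end-member (checked by hand in NOTES.md):
`w = Σ_x p_x [(Φq)_{x+1} − (Φq)_{x−1}]` truncated at the ends is admissible with `Π₀`, NOT with the
strict all-even projection — the contact rule is essential in finite volume.

Stubs (sorried, registered): `stub_nessExistsUnique` (clause (i), print-level), `stub_kuboThomson`
(fixed-`N` Kubo identity + Thomson principle, scale-free form), `stub_sectorCoercivity` (parity/OU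
coercivity of the symmetric part), `stub_halfConservedWitness` (LOAD-BEARING, ε-free: the witness family),
`stub_responseConverges` (IMPORT SLOT: existence of `lim_N D_N(ε)`, the other half of (ii), delivered by
the sibling lines `abel-kapitza-even-corrector` / `parity-coercive-one-sided-fekete`).
Composition (sorry-free): `flipFouriersLawFor_of_parts`, `NoisyFourier_of` (hypotheses keyed by the
registered stub names, `Registered.stub_*`), wiring `example`.
-/

noncomputable section

open MeasureTheory Filter Topology Set Function
open scoped ContDiff BigOperators

namespace Summit.AtomisticToContinuum.FouriersLaw.Cruxes.NoisyFourier.HalfConservedWitness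

open Literature.MathematicalPhysics.KineticTheory.HeatConduction
open Summit.AtomisticToContinuum.FouriersLaw.Theses.VanishingNoiseTransfer (NoisyFourier)

/-! ## 0. The crux in `FlipFouriersLawFor` form -/

/-- The route decl `NoisyFourier` binds the flip steady-state predicate once as `S` with a defining
equation; it IS `∀ parameters > 0, ∀ ε > 0, FlipFouriersLawFor (pinnedChain …) ε` (the inlined `S` is
`IsFlipSteadyState` by `rfl`, `OscillatorChain.isFlipSteadyState_fun_eq`). [folklore] -/
theorem noisyFourier_iff :
    NoisyFourier ↔ ∀ ω₂ lam β γ : ℝ, 0 < ω₂ → 0 < lam → 0 < β → 0 < γ → ∀ ε : ℝ, 0 < ε →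
      (pinnedChain ω₂ lam β γ).FlipFouriersLawFor ε := by
  constructor
  · intro h ω₂ lam β γ hω hl hβ hγ ε hε
    exact h ω₂ lam β γ hω hl hβ hγ _ rfl ε hε
  · intro h ω₂ lam β γ hω hl hβ hγ S hS ε hε
    subst hS
    exact h ω₂ lam β γ hω hl hβ hγ ε hε

/-! ## 1. The functionals of the line (finite volume, equilibrium `T`, Gibbs measure `G`) -/

variable {N : ℕ}

/-- The total current FUNCTION `J_N = Σ_i j_i` (so that `totalCurrent μ = ∫ J_N dμ` when the bond currents
are integrable). [folklore] -/
def totalCurrentFun (P : OscillatorChain) (N : ℕ) (x : PhaseSpace N) : ℝ :=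
  ∑ i : Fin N, P.bondCurrent N i x

/-- The flip Dirichlet form `½ Σ_i ∫ (g ∘ Θ_i − g)² dG = ⟨g, (−S) g⟩_{L²(G)}` (for a flip-invariant `G`;
`S` = `flipNoise`, BernardinOlla2011 §2.1). Manifestly `≥ 0`. -/
def flipForm (N : ℕ) (G : Measure (PhaseSpace N)) (g : PhaseSpace N → ℝ) : ℝ :=
  (1 / 2) * ∑ i : Fin N, ∫ x, (g (momentumFlip i x) - g x) ^ 2 ∂G

/-- The bath Dirichlet form `Σ_{bath sites} ∫ (∂_{p_i} g)² dG` over the generator's bath sites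
`i.val = 0` and `i.val = N − 1` (`⟨g, −(T ∂²_{p_i} − p_i ∂_{p_i}) g⟩_{N(0,T)} = T ∫ (∂_{p_i} g)²`, so the
bath part of `⟨g, −L_{N,ε} g⟩_{L²(Gibbs_T)}` is `γ T · bathForm`). Manifestly `≥ 0`. -/
def bathForm (N : ℕ) (G : Measure (PhaseSpace N)) (g : PhaseSpace N → ℝ) : ℝ :=
  ∑ i : Fin N, ((if i.val = 0 then ∫ x, (partialP i g x) ^ 2 ∂G else 0) +
    (if i.val = N - 1 then ∫ x, (partialP i g x) ^ 2 ∂G else 0))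

/-- The symmetric (noise + baths) Dirichlet form of `L_{N,ε} = L_H + εS + γ(B_0 + B_{N−1})` at equilibrium
`T`: `‖g‖₁² := ⟨g, −L_{N,ε} g⟩ = ε · flipForm g + γ T · bathForm g` (the Liouvillian is antisymmetric).
-/
def dirichletForm (N : ℕ) (G : Measure (PhaseSpace N)) (ε γ T : ℝ) (g : PhaseSpace N → ℝ) : ℝ :=
  ε * flipForm N G g + γ * T * bathForm N G g

/-- TEMPERED test functions: `C²` with the function and its first coordinate partials bounded by a power
of `1 + H_N` (polynomial growth measured by the chain's own energy; all Gibbs moments are then finite).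
The class is a cone (closed under scaling), which the scale-free Thomson inequality uses. -/
def IsTempered (P : OscillatorChain) (N : ℕ) (w : PhaseSpace N → ℝ) : Prop :=
  ContDiff ℝ 2 w ∧ ∃ C : ℝ, ∃ k : ℕ, ∀ x : PhaseSpace N,
    |w x| ≤ C * (1 + P.hamiltonian N x) ^ k ∧
      ∀ i : Fin N, |partialQ i w x| ≤ C * (1 + P.hamiltonian N x) ^ k ∧
        |partialP i w x| ≤ C * (1 + P.hamiltonian N x) ^ k

/-- PARITY ADMISSIBILITY ("half-conservation" in finite volume, with the contact rule built in):
`f ⊥ ker K` in `L²(G)`, i.e. `∫ f φ dG = 0` for every bounded continuous `φ` that is even in EACH momentum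
(`φ ∘ Θ_i = φ`, the kernel of the flip noise) and independent of the bath momenta `p_0, p_{N−1}` (the
kernel of the two Ornstein–Uhlenbeck bath operators). Applied to `f = L_H w`: only the all-even,
bath-invisible component of the Liouville image must vanish; the sectors `H_2, H_4, …` and the
`p_0, p_{N−1}`-dependent all-even data are free (they cost `1/(2 min(ε,γ))`, `stub_sectorCoercivity`). -/
def IsParityAdmissible (N : ℕ) (G : Measure (PhaseSpace N)) (f : PhaseSpace N → ℝ) : Prop :=
  ∀ φ : PhaseSpace N → ℝ, Continuous φ → (∃ C : ℝ, ∀ x, |φ x| ≤ C) →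
    (∀ (i : Fin N) (x : PhaseSpace N), φ (momentumFlip i x) = φ x) →
    (∀ i : Fin N, (i.val = 0 ∨ i.val = N - 1) →
      ∀ (x : PhaseSpace N) (t : ℝ), φ (x.1, Function.update x.2 i t) = φ x) →
    ∫ x, f x * φ x ∂G = 0

/-! ## 2. The five statements -/

/-- Statement of `stub_nessExistsUnique` — CLAUSE (i) OF THE CRUX (print-level): for all parameters `> 0`,
every flip rate `ε > 0`, every `N` and `T_L, T_R > 0`, the weak steady state of `L + εS` (class
`IsFlipSteadyState`: probability, `∫ (L + εS) f dμ = 0` on `C_c^∞`, bond currents integrable) exists and is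
unique. Print template: BernardinOlla2011 Prop. 1 + §8 p.19 (unpinned chain: Lyapunov `e^{θΣE_x}`, first-flip
Duhamel, Rey-Bellet's Harris theorem) on top of CuneoEckmannHairerReyBellet2018 Thm 2.13 / Carmona2007 for
the pinned chain, plus the Echeverría-type identification of weak Fokker–Planck solutions of the
jump-diffusion with invariant measures (same step as route item `NessUnique`, stmt-0741). Honours
`noisyFourier_false_without_bathCoupling` of Disproof.lean (γ > 0 is used: at γ = 0 Dirac and Gibbs are two
steady states). [difficulty L] -/
def NoisyNessExistsUnique : Prop :=
  ∀ ω₂ lam β γ : ℝ, 0 < ω₂ → 0 < lam → 0 < β → 0 < γ → ∀ ε : ℝ, 0 < ε →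
    ∀ (N : ℕ) (T_L T_R : ℝ), 0 < T_L → 0 < T_R →
      ∃ μ : Measure (PhaseSpace N), (pinnedChain ω₂ lam β γ).IsFlipSteadyState N T_L T_R ε μ ∧
        ∀ ν : Measure (PhaseSpace N), (pinnedChain ω₂ lam β γ).IsFlipSteadyState N T_L T_R ε ν → ν = μ

/-- Statement of `stub_kuboThomson` — FIXED-`N` KUBO IDENTITY + THOMSON PRINCIPLE (scale-free form): for
`N ≥ 2`, `ε > 0`, `T > 0` and the UNIQUE flip-steady family `μ` at this `N` (triage sharpening: uniqueness is
a hypothesis, cf. stmt-0705 vs 0717), the response `d = lim_{δ→0,δ≠0} totalCurrent(μ_{T+δ/2,T−δ/2})/δ`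
exists and, for every tempered `w` and every `M` dominating the dual cost
`sup_{g ∈ C_c^∞} {2 ∫ (L_H w) g dG − ‖g‖₁²} ≤ M` (`G` = Gibbs at `T`, `‖·‖₁² = dirichletForm`):
`(∫ w J_N dG)² ≤ (N−1) T² d (‖w‖₁² + M)`.
Content: (a) fixed-`N` linear response for the hypoelliptic jump-diffusion `L + εS` (HairerMajda2009
framework; ReyBellet2003 Rem. 4.4) and the open-chain Green–Kubo identity `(N−1)T² D_N(ε) = ⟨J_N,
(−L_{N,ε})⁻¹ J_N⟩_{L²(Gibbs_T)}` (KunduDharNarayan2009; generalised detailed balance `ΠLΠ = L†` holds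
because `S` commutes with the momentum reversal; verified to 1e−7 on harmonic + flips by triage r1-2/r1-3,
kit j006727/j006719); (b) the resolvent variational formula `⟨J,(λ−L)⁻¹J⟩ = sup_w {2⟨w,J⟩ − ‖w‖²_{1,λ} −
‖L_H w‖²_{−1,λ}}` (BernardinOlla2011 eq. (var) p.13; Komorowski–Landim–Olla, Fluctuations in Markov
Processes, §2) at `λ ↓ 0`, then optimisation over the scale of `w`. [difficulty L+] -/
def FlipKuboThomson : Prop :=
  ∀ ω₂ lam β γ : ℝ, 0 < ω₂ → 0 < lam → 0 < β → 0 < γ → ∀ ε : ℝ, 0 < ε → ∀ T : ℝ, 0 < T →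
    ∀ N : ℕ, 2 ≤ N → ∀ μ : ℝ → ℝ → Measure (PhaseSpace N),
      (∀ T_L T_R : ℝ, 0 < T_L → 0 < T_R →
        (pinnedChain ω₂ lam β γ).IsFlipSteadyState N T_L T_R ε (μ T_L T_R) ∧
          ∀ ν : Measure (PhaseSpace N),
            (pinnedChain ω₂ lam β γ).IsFlipSteadyState N T_L T_R ε ν → ν = μ T_L T_R) →
      ∃ d : ℝ,
        Tendsto (fun δ : ℝ => (pinnedChain ω₂ lam β γ).totalCurrent (μ (T + δ / 2) (T - δ / 2)) / δ)
          (𝓝[≠] 0) (𝓝 d) ∧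
        ∀ (w : PhaseSpace N → ℝ) (M : ℝ), IsTempered (pinnedChain ω₂ lam β γ) N w →
          (∀ g : PhaseSpace N → ℝ, ContDiff ℝ ∞ g → HasCompactSupport g →
            2 * ∫ x, (pinnedChain ω₂ lam β γ).liouvillian N w x * g x
                ∂(pinnedChain ω₂ lam β γ).gibbsMeasure N T -
              dirichletForm N ((pinnedChain ω₂ lam β γ).gibbsMeasure N T) ε γ T g ≤ M) →
          (∫ x, w x * totalCurrentFun (pinnedChain ω₂ lam β γ) N x
              ∂(pinnedChain ω₂ lam β γ).gibbsMeasure N T) ^ 2 ≤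
            ((N : ℝ) - 1) * T ^ 2 * d *
              (dirichletForm N ((pinnedChain ω₂ lam β γ).gibbsMeasure N T) ε γ T w + M)

/-- Statement of `stub_sectorCoercivity` — PARITY/ORNSTEIN–UHLENBECK COERCIVITY OF THE SYMMETRIC PART: for
`f ∈ L²(Gibbs_T)` with `Π₀ f = 0` (`IsParityAdmissible`) and every `g ∈ C_c^∞`,
`2 ∫ f g dG − ‖g‖₁² ≤ ‖f‖²_{L²(G)} / (2 min(ε,γ))`, i.e. `‖f‖₋₁² ≤ ‖f‖² / (2 min(ε,γ))`.
Content: under the Gibbs measure the momenta are i.i.d. `N(0,T)` independent of the positions; in the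
product Hermite basis `S` multiplies the sector with `W` odd sites by `−2W` (BernardinOlla2011 Lemma 2, p.11)
and `−B_j` is the number operator in `p_j`, so `−K = −εS − γ(B_0+B_{N−1}) ≥ 2 min(ε,γ)` on `(ker K)^⊥`,
`ker K` = all-even ∩ independent of `p_0, p_{N−1}`; then `2⟨f,g⟩ − ⟨g,−Kg⟩ ≤ 2‖f‖‖g^⊥‖ − 2min(ε,γ)‖g^⊥‖²`.
Tree: `MomentumHermiteLadder` (Hermite calculus), `VelocityFlipNoise` (`S` symmetric, mean zero),
Mathlib `gaussianReal`. [difficulty M] -/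
def FlipSectorCoercivity : Prop :=
  ∀ ω₂ lam β γ : ℝ, 0 < ω₂ → 0 < lam → 0 < β → 0 < γ → ∀ ε : ℝ, 0 < ε → ∀ T : ℝ, 0 < T →
    ∀ N : ℕ, 2 ≤ N → ∀ f : PhaseSpace N → ℝ,
      MemLp f 2 ((pinnedChain ω₂ lam β γ).gibbsMeasure N T) →
      IsParityAdmissible N ((pinnedChain ω₂ lam β γ).gibbsMeasure N T) f →
      ∀ g : PhaseSpace N → ℝ, ContDiff ℝ ∞ g → HasCompactSupport g →
        2 * ∫ x, f x * g x ∂(pinnedChain ω₂ lam β γ).gibbsMeasure N T -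
            dirichletForm N ((pinnedChain ω₂ lam β γ).gibbsMeasure N T) ε γ T g ≤
          (∫ x, f x ^ 2 ∂(pinnedChain ω₂ lam β γ).gibbsMeasure N T) / (2 * min ε γ)

/-- Statement of `stub_halfConservedWitness` — THE LOAD-BEARING, ε-FREE WITNESS FAMILY (the card's
`HalfConservedWitness` in finite volume with the contact rule): for all parameters `> 0` and `T > 0` there
are `c₁ > 0`, `c₂` and `N₀` such that for every `N ≥ N₀` some tempered `w_N` IN THE ONE-ODD-SITE SECTOR
`H_{W=1}` (`S w_N = −2 w_N`: a sum of fields each odd in exactly one momentum and even in the others — the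
card's Hermite-tower class `Σ_x Σ_{n odd} h_n(p_x) G_{x,n}(q; p²_{≠x})`; the Π-odd Kubo corrector itself has
`W = 3, 5, …` components, so this is a genuine restriction and the statement is NOT the Thomson dual of
positivity) has a square-integrable, PARITY-ADMISSIBLE Liouville image `L_H w_N` (`Π₀(L_H w_N) = 0`:
half-conserved up to bath-absorbable contact data), extensive pairing `c₁ (N−1) ≤ ∫ w_N J_N dG_T` and
extensive coarse costs `flipForm(w_N), bathForm(w_N), ‖L_H w_N‖²_{L²(G_T)} ≤ c₂ (N−1)`. NO `ε` APPEARS: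
one static family serves every noise level. Intended construction (idea card): translates of ONE
local/quasi-local odd field
`w = Σ_x Σ_{n odd} h_n(p_x) G_{x,n}(q; p²)` solving the Hermite tower `P₀ L_H w ≡ 0` (level 0: a
`ρ`-divergence-free stream field; levels `m ≥ 2`: one-dimensional quadratures, solvable iff conditional
means vanish), truncated at the ends where the bath cells absorb the all-even defects of zero conditional
mean (harmonic check: `w_h = Σ_x p_x[(Φq)_{x+1} − (Φq)_{x−1}]`, defect `p²_{N−1} − p²_0`). Strictly
stronger than positivity (ε-free, coarse cost, exact admissibility) — not a costume; existence for the
PINNED anharmonic chain is the open bet (level-2 obstruction `E_T[V″(r_x) − V″(r_{x+1}) | rest] ≠ 0`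
for the naive seed; killing test = least singular value of the level-2 defect map, idea card falsifier (2),
unrun). Sources: BernardinOlla2011 Prop. 4, Prop. 8, §6.2; FritzFunakiLebowitz1994 Thm 2.2; tree
`MomentumHermiteLadder` (`R`, `R†`, `hermiteFun`). [difficulty XL] -/
def HalfConservedWitnessFamily : Prop :=
  ∀ ω₂ lam β γ : ℝ, 0 < ω₂ → 0 < lam → 0 < β → 0 < γ → ∀ T : ℝ, 0 < T →
    ∃ c₁ c₂ : ℝ, 0 < c₁ ∧ ∃ N₀ : ℕ, ∀ N : ℕ, N₀ ≤ N →
      ∃ w : PhaseSpace N → ℝ, IsTempered (pinnedChain ω₂ lam β γ) N w ∧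
        (∀ x : PhaseSpace N, flipNoise N w x = -2 * w x) ∧
        MemLp ((pinnedChain ω₂ lam β γ).liouvillian N w) 2 ((pinnedChain ω₂ lam β γ).gibbsMeasure N T) ∧
        IsParityAdmissible N ((pinnedChain ω₂ lam β γ).gibbsMeasure N T)
          ((pinnedChain ω₂ lam β γ).liouvillian N w) ∧
        c₁ * ((N : ℝ) - 1) ≤ ∫ x, w x * totalCurrentFun (pinnedChain ω₂ lam β γ) N x
          ∂(pinnedChain ω₂ lam β γ).gibbsMeasure N T ∧
        flipForm N ((pinnedChain ω₂ lam β γ).gibbsMeasure N T) w ≤ c₂ * ((N : ℝ) - 1) ∧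
        bathForm N ((pinnedChain ω₂ lam β γ).gibbsMeasure N T) w ≤ c₂ * ((N : ℝ) - 1) ∧
        ∫ x, ((pinnedChain ω₂ lam β γ).liouvillian N w x) ^ 2
          ∂(pinnedChain ω₂ lam β γ).gibbsMeasure N T ≤ c₂ * ((N : ℝ) - 1)

/-- Statement of `stub_responseConverges` — IMPORT SLOT (the EXISTENCE half of clause (ii), not this line's
mechanism): under clause (i) at rate `ε`, along every flip-steady family and at every `T > 0` the responses
`D_N(ε)` exist for all `N` AND converge to some real `k` (no sign claimed). Delivered by the sibling lines of
this crux: `abel-kapitza-even-corrector` (`NoisyBoundedResponse` + the Kapitza bound ⇒ Moore–Osgood in the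
Abel variable) or `sector-dirichlet-gluing` / `parity-coercive-one-sided-fekete` (near-additivity of
`(N−1)D_N(ε)` + Fekete); printed only for the harmonic bulk (BernardinOlla2011 Thm 3;
BernardinKannanLebowitzLukkarinen2012). With positivity from stubs 2–4 it is clause (ii). [difficulty XL] -/
def NoisyResponseConverges : Prop :=
  ∀ ω₂ lam β γ : ℝ, 0 < ω₂ → 0 < lam → 0 < β → 0 < γ → ∀ ε : ℝ, 0 < ε →
    (∀ (N : ℕ) (T_L T_R : ℝ), 0 < T_L → 0 < T_R →
      ∃ μ : Measure (PhaseSpace N), (pinnedChain ω₂ lam β γ).IsFlipSteadyState N T_L T_R ε μ ∧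
        ∀ ν : Measure (PhaseSpace N), (pinnedChain ω₂ lam β γ).IsFlipSteadyState N T_L T_R ε ν → ν = μ) →
    ∀ μ : (N : ℕ) → ℝ → ℝ → Measure (PhaseSpace N),
      (∀ (N : ℕ) (T_L T_R : ℝ), 0 < T_L → 0 < T_R →
        (pinnedChain ω₂ lam β γ).IsFlipSteadyState N T_L T_R ε (μ N T_L T_R)) →
      ∀ T : ℝ, 0 < T → ∃ D : ℕ → ℝ, ∃ k : ℝ,
        (∀ N : ℕ, Tendsto (fun δ : ℝ =>
            (pinnedChain ω₂ lam β γ).totalCurrent (μ N (T + δ / 2) (T - δ / 2)) / δ) (𝓝[≠] 0) (𝓝 (D N))) ∧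
        Tendsto D atTop (𝓝 k)

/-! ## 3. The registered stubs (the ONLY sorries of this file) -/

/-- STUB 1 (clause (i); print-level, L). -/
theorem stub_nessExistsUnique : NoisyNessExistsUnique := by
  sorry

/-- STUB 2 (fixed-`N` Kubo identity + Thomson principle; L+). -/
theorem stub_kuboThomson : FlipKuboThomson := by
  sorry

/-- STUB 3 (parity/OU coercivity of the symmetric part; M). -/
theorem stub_sectorCoercivity : FlipSectorCoercivity := by
  sorry

/-- STUB 4 (the ε-free half-conserved witness family; LOAD-BEARING, XL). -/
theorem stub_halfConservedWitness : HalfConservedWitnessFamily := by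
  sorry

/-- STUB 5 (IMPORT SLOT: convergence of the noisy responses; XL, sibling lines). -/
theorem stub_responseConverges : NoisyResponseConverges := by
  sorry

/-! ### Name-keyed aliases of the five statements (hypotheses of the composition)

`Registered.stub_X` is statement `X` under the registered stub's short name, so that the native skeleton
audit (`#h21_check_skeleton`: hypotheses admissible iff registered obligations / declared stubs BY NAME)
accepts `NoisyFourier_of : Registered.stub_nessExistsUnique → … → NoisyFourier` (device of
`Cruxes/LagHandOff/Lines/crosscut-dictionary.lean`). -/
namespace Registered

/-- Alias of `NoisyNessExistsUnique` keyed by the registered stub name. -/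
abbrev stub_nessExistsUnique : Prop := NoisyNessExistsUnique
/-- Alias of `FlipKuboThomson` keyed by the registered stub name. -/
abbrev stub_kuboThomson : Prop := FlipKuboThomson
/-- Alias of `FlipSectorCoercivity` keyed by the registered stub name. -/
abbrev stub_sectorCoercivity : Prop := FlipSectorCoercivity
/-- Alias of `HalfConservedWitnessFamily` keyed by the registered stub name. -/
abbrev stub_halfConservedWitness : Prop := HalfConservedWitnessFamily
/-- Alias of `NoisyResponseConverges` keyed by the registered stub name. -/
abbrev stub_responseConverges : Prop := NoisyResponseConverges

end Registered

/-! ## 4. Sorry-free glue -/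

/-- Nonnegativity of the flip form. [folklore] -/
theorem flipForm_nonneg (N : ℕ) (G : Measure (PhaseSpace N)) (g : PhaseSpace N → ℝ) :
    0 ≤ flipForm N G g := by
  unfold flipForm
  refine mul_nonneg (by norm_num) (Finset.sum_nonneg fun i _ => ?_)
  exact integral_nonneg fun x => sq_nonneg _

/-- Nonnegativity of the bath form. [folklore] -/
theorem bathForm_nonneg (N : ℕ) (G : Measure (PhaseSpace N)) (g : PhaseSpace N → ℝ) :
    0 ≤ bathForm N G g := by
  unfold bathForm
  refine Finset.sum_nonneg fun i _ => add_nonneg ?_ ?_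
  · split_ifs
    · exact integral_nonneg fun x => sq_nonneg _
    · exact le_rfl
  · split_ifs
    · exact integral_nonneg fun x => sq_nonneg _
    · exact le_rfl

/-- A family of measures chosen at positive temperatures from a pointwise existence statement. [folklore] -/
theorem famChoice {Q : (N : ℕ) → ℝ → ℝ → Measure (PhaseSpace N) → Prop}
    (hQ : ∀ (N : ℕ) (T_L T_R : ℝ), 0 < T_L → 0 < T_R → ∃ μ, Q N T_L T_R μ) :
    ∃ fam : (N : ℕ) → ℝ → ℝ → Measure (PhaseSpace N),
      ∀ (N : ℕ) (T_L T_R : ℝ), 0 < T_L → 0 < T_R → Q N T_L T_R (fam N T_L T_R) := by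
  classical
  refine ⟨fun N T_L T_R => if h : 0 < T_L ∧ 0 < T_R then (hQ N T_L T_R h.1 h.2).choose else 0,
    fun N T_L T_R hL hR => ?_⟩
  simp only [dif_pos (And.intro hL hR)]
  exact (hQ N T_L T_R hL hR).choose_spec

/-- **The positivity lever, one `N` at a time** (sorry-free): Kubo–Thomson + sector coercivity + one
admissible witness with pairing `≥ c₁(N−1)` and coarse costs `≤ c₂(N−1)` give
`c₁² ≤ T² (ε + γT + 1/(2 min(ε,γ))) c₂ · d` for the response `d` of the unique family — and `c₂ > 0`. -/
theorem floor_at (h2 : FlipKuboThomson) (h3 : FlipSectorCoercivity)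
    {ω₂ lam β γ ε T : ℝ} (hω : 0 < ω₂) (hl : 0 < lam) (hβ : 0 < β) (hγ : 0 < γ) (hε : 0 < ε)
    (hT : 0 < T) {N : ℕ} (hN : 2 ≤ N) (μ : ℝ → ℝ → Measure (PhaseSpace N))
    (hμ : ∀ T_L T_R : ℝ, 0 < T_L → 0 < T_R →
      (pinnedChain ω₂ lam β γ).IsFlipSteadyState N T_L T_R ε (μ T_L T_R) ∧
        ∀ ν : Measure (PhaseSpace N),
          (pinnedChain ω₂ lam β γ).IsFlipSteadyState N T_L T_R ε ν → ν = μ T_L T_R)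
    {d : ℝ} (hd : Tendsto (fun δ : ℝ =>
      (pinnedChain ω₂ lam β γ).totalCurrent (μ (T + δ / 2) (T - δ / 2)) / δ) (𝓝[≠] 0) (𝓝 d))
    {c₁ c₂ : ℝ} (hc₁ : 0 < c₁) (w : PhaseSpace N → ℝ)
    (hwT : IsTempered (pinnedChain ω₂ lam β γ) N w)
    (hAw : MemLp ((pinnedChain ω₂ lam β γ).liouvillian N w) 2 ((pinnedChain ω₂ lam β γ).gibbsMeasure N T))
    (hadm : IsParityAdmissible N ((pinnedChain ω₂ lam β γ).gibbsMeasure N T)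
      ((pinnedChain ω₂ lam β γ).liouvillian N w))
    (hpair : c₁ * ((N : ℝ) - 1) ≤ ∫ x, w x * totalCurrentFun (pinnedChain ω₂ lam β γ) N x
      ∂(pinnedChain ω₂ lam β γ).gibbsMeasure N T)
    (hflip : flipForm N ((pinnedChain ω₂ lam β γ).gibbsMeasure N T) w ≤ c₂ * ((N : ℝ) - 1))
    (hbath : bathForm N ((pinnedChain ω₂ lam β γ).gibbsMeasure N T) w ≤ c₂ * ((N : ℝ) - 1))
    (hA : ∫ x, ((pinnedChain ω₂ lam β γ).liouvillian N w x) ^ 2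
      ∂(pinnedChain ω₂ lam β γ).gibbsMeasure N T ≤ c₂ * ((N : ℝ) - 1)) :
    c₁ ^ 2 ≤ T ^ 2 * (ε + γ * T + 1 / (2 * min ε γ)) * c₂ * d ∧ 0 < c₂ := by
  obtain ⟨d', hd', hthom⟩ := h2 ω₂ lam β γ hω hl hβ hγ ε hε T hT N hN μ hμ
  have hdd : d' = d := tendsto_nhds_unique hd' hd
  rw [hdd] at hthom
  set G := (pinnedChain ω₂ lam β γ).gibbsMeasure N T with hG
  set A : ℝ := ∫ x, ((pinnedChain ω₂ lam β γ).liouvillian N w x) ^ 2 ∂G with hAdef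
  have hm : 0 < min ε γ := lt_min hε hγ
  set M : ℝ := A / (2 * min ε γ) with hM
  have hMbound : ∀ g : PhaseSpace N → ℝ, ContDiff ℝ ∞ g → HasCompactSupport g →
      2 * ∫ x, (pinnedChain ω₂ lam β γ).liouvillian N w x * g x ∂G - dirichletForm N G ε γ T g ≤ M :=
    fun g hg hgc => h3 ω₂ lam β γ hω hl hβ hγ ε hε T hT N hN _ hAw hadm g hg hgc
  have hineq := hthom w M hwT hMbound
  -- abbreviations
  set a : ℝ := (N : ℝ) - 1 with ha
  set X : ℝ := dirichletForm N G ε γ T w + M with hX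
  set I : ℝ := ∫ x, w x * totalCurrentFun (pinnedChain ω₂ lam β γ) N x ∂G with hI
  have ha0 : 0 < a := by
    have : (2 : ℝ) ≤ (N : ℝ) := by exact_mod_cast hN
    rw [ha]; linarith
  have hA0 : 0 ≤ A := integral_nonneg fun x => sq_nonneg _
  have hM0 : 0 ≤ M := div_nonneg hA0 (by positivity)
  have hF0 := flipForm_nonneg N G w
  have hB0 := bathForm_nonneg N G w
  have hX0 : 0 ≤ X := by
    rw [hX, dirichletForm]
    have h1 : 0 ≤ ε * flipForm N G w := mul_nonneg hε.le hF0
    have h2 : 0 ≤ γ * T * bathForm N G w := mul_nonneg (mul_nonneg hγ.le hT.le) hB0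
    linarith
  set Λ : ℝ := ε + γ * T + 1 / (2 * min ε γ) with hΛ
  have hΛ0 : 0 < Λ := by rw [hΛ]; positivity
  have hXle : X ≤ Λ * c₂ * a := by
    have h1 : ε * flipForm N G w ≤ ε * (c₂ * a) := mul_le_mul_of_nonneg_left hflip hε.le
    have h2 : γ * T * bathForm N G w ≤ γ * T * (c₂ * a) :=
      mul_le_mul_of_nonneg_left hbath (mul_nonneg hγ.le hT.le)
    have h3 : M ≤ c₂ * a / (2 * min ε γ) := div_le_div_of_nonneg_right hA (by positivity)
    have hsum : Λ * c₂ * a = ε * (c₂ * a) + γ * T * (c₂ * a) + c₂ * a / (2 * min ε γ) := by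
      rw [hΛ]; ring
    rw [hsum, hX, dirichletForm]
    linarith
  -- the scale-free Thomson inequality with the witness: (c₁ a)² ≤ I² ≤ a T² d X
  have hca : 0 ≤ c₁ * a := mul_nonneg hc₁.le ha0.le
  have hsq : (c₁ * a) ^ 2 ≤ I ^ 2 := pow_le_pow_left₀ hca hpair 2
  have hmain : (c₁ * a) ^ 2 ≤ a * T ^ 2 * d * X := hsq.trans hineq
  -- hence c₁² a ≤ T² d X, so d X > 0, X > 0, d > 0
  have hmain' : c₁ ^ 2 * a ≤ T ^ 2 * d * X := by
    have h : a * (c₁ ^ 2 * a) ≤ a * (T ^ 2 * d * X) := by nlinarith [hmain]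
    exact le_of_mul_le_mul_left h ha0
  have hlhs : 0 < c₁ ^ 2 * a := by positivity
  have hdX : 0 < d * X := by
    have hT2 : 0 < T ^ 2 := by positivity
    by_contra hle
    have hle := not_lt.mp hle
    have : T ^ 2 * d * X ≤ 0 := by
      have : T ^ 2 * (d * X) ≤ 0 := mul_nonpos_of_nonneg_of_nonpos hT2.le hle
      linarith [show T ^ 2 * d * X = T ^ 2 * (d * X) by ring]
    linarith
  have hXpos : 0 < X := by
    rcases hX0.lt_or_eq with h | h
    · exact h
    · exfalso; rw [← h, mul_zero] at hdX; exact lt_irrefl _ hdX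
  have hdpos : 0 < d := by
    by_contra hle
    have hle := not_lt.mp hle
    have : d * X ≤ 0 := mul_nonpos_of_nonpos_of_nonneg hle hXpos.le
    linarith
  have hc₂ : 0 < c₂ := by
    have h : 0 < Λ * c₂ * a := hXpos.trans_le hXle
    by_contra hle
    have hle := not_lt.mp hle
    have h' : (Λ * a) * c₂ ≤ 0 := mul_nonpos_of_nonneg_of_nonpos (by positivity) hle
    linarith [show Λ * c₂ * a = (Λ * a) * c₂ by ring]
  refine ⟨?_, hc₂⟩
  -- c₁² a ≤ T² d X ≤ T² d Λ c₂ a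
  have hstep : T ^ 2 * d * X ≤ T ^ 2 * d * (Λ * c₂ * a) :=
    mul_le_mul_of_nonneg_left hXle (by positivity)
  have hfin : c₁ ^ 2 * a ≤ (T ^ 2 * Λ * c₂ * d) * a := by
    calc c₁ ^ 2 * a ≤ T ^ 2 * d * X := hmain'
      _ ≤ T ^ 2 * d * (Λ * c₂ * a) := hstep
      _ = (T ^ 2 * Λ * c₂ * d) * a := by ring
  calc c₁ ^ 2 = (c₁ ^ 2 * a) / a := by field_simp
    _ ≤ ((T ^ 2 * Λ * c₂ * d) * a) / a := div_le_div_of_nonneg_right hfin ha0.le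
    _ = T ^ 2 * (ε + γ * T + 1 / (2 * min ε γ)) * c₂ * d := by rw [hΛ]; field_simp

/-- **The line, composed** (sorry-free): the five statements give `FlipFouriersLawFor` at every `ε > 0`.
Clause (i) is stub 1; for clause (ii) take the unique family `μs`, its responses `D` and their limit `k`
(stub 5); for `N ≥ max N₀ 2` the witness (stub 4) fed into Kubo–Thomson (stub 2) with the coercive cost
(stub 3) floors `D_N ≥ c₁²/(T² Λ c₂) > 0`, so `k > 0`; `κ_ε(T) := k`; every other flip family coincides with
`μs` at positive temperatures (uniqueness), so its response quotients agree near `δ = 0`. -/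
theorem flipFouriersLawFor_of_parts (h1 : NoisyNessExistsUnique) (h2 : FlipKuboThomson)
    (h3 : FlipSectorCoercivity) (h4 : HalfConservedWitnessFamily) (h5 : NoisyResponseConverges)
    {ω₂ lam β γ ε : ℝ} (hω : 0 < ω₂) (hl : 0 < lam) (hβ : 0 < β) (hγ : 0 < γ) (hε : 0 < ε) :
    (pinnedChain ω₂ lam β γ).FlipFouriersLawFor ε := by
  classical
  have hU := h1 ω₂ lam β γ hω hl hβ hγ ε hε
  refine ⟨hU, ?_⟩
  -- the unique flip-steady family
  obtain ⟨μs, hμs'⟩ := famChoice hU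
  have hμs : ∀ (N : ℕ) (T_L T_R : ℝ), 0 < T_L → 0 < T_R →
      (pinnedChain ω₂ lam β γ).IsFlipSteadyState N T_L T_R ε (μs N T_L T_R) :=
    fun N T_L T_R hL hR => (hμs' N T_L T_R hL hR).1
  have huniq : ∀ (N : ℕ) (T_L T_R : ℝ), 0 < T_L → 0 < T_R → ∀ ν : Measure (PhaseSpace N),
      (pinnedChain ω₂ lam β γ).IsFlipSteadyState N T_L T_R ε ν → ν = μs N T_L T_R :=
    fun N T_L T_R hL hR ν hν => (hμs' N T_L T_R hL hR).2 ν hν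
  -- responses, their limit, and the floor, at each temperature
  have key : ∀ T : ℝ, 0 < T → ∃ D : ℕ → ℝ, ∃ k : ℝ, 0 < k ∧
      (∀ N : ℕ, Tendsto (fun δ : ℝ =>
        (pinnedChain ω₂ lam β γ).totalCurrent (μs N (T + δ / 2) (T - δ / 2)) / δ) (𝓝[≠] 0) (𝓝 (D N))) ∧
      Tendsto D atTop (𝓝 k) := by
    intro T hT
    obtain ⟨D, k, hD, hDk⟩ := h5 ω₂ lam β γ hω hl hβ hγ ε hε hU μs hμs T hT
    obtain ⟨c₁, c₂, hc₁, N₀, hw⟩ := h4 ω₂ lam β γ hω hl hβ hγ T hT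
    set Λ : ℝ := ε + γ * T + 1 / (2 * min ε γ) with hΛ
    have hm : 0 < min ε γ := lt_min hε hγ
    have hΛ0 : 0 < Λ := by rw [hΛ]; positivity
    have hfloor : ∀ N : ℕ, max N₀ 2 ≤ N → c₁ ^ 2 ≤ T ^ 2 * Λ * c₂ * D N ∧ 0 < c₂ := by
      intro N hN
      have hN₀ : N₀ ≤ N := le_trans (le_max_left _ _) hN
      have hN2 : 2 ≤ N := le_trans (le_max_right _ _) hN
      obtain ⟨w, hwT, -, hAw, hadm, hpair, hflip, hbath, hA⟩ := hw N hN₀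
      exact floor_at h2 h3 hω hl hβ hγ hε hT hN2 (μs N)
        (fun T_L T_R hL hR => ⟨hμs N T_L T_R hL hR, huniq N T_L T_R hL hR⟩) (hD N) hc₁ w hwT hAw hadm
        hpair hflip hbath hA
    have hc₂ : 0 < c₂ := (hfloor (max N₀ 2) le_rfl).2
    set f₀ : ℝ := c₁ ^ 2 / (T ^ 2 * Λ * c₂) with hf₀
    have hden : 0 < T ^ 2 * Λ * c₂ := by positivity
    have hf₀pos : 0 < f₀ := by rw [hf₀]; positivity
    have hev : ∀ᶠ N in atTop, f₀ ≤ D N := by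
      refine eventually_atTop.2 ⟨max N₀ 2, fun N hN => ?_⟩
      have h := (hfloor N hN).1
      rw [hf₀, div_le_iff₀ hden]
      linarith [show T ^ 2 * Λ * c₂ * D N = D N * (T ^ 2 * Λ * c₂) by ring]
    have hk : f₀ ≤ k := ge_of_tendsto hDk hev
    exact ⟨D, k, hf₀pos.trans_le hk, hD, hDk⟩
  -- the conductivity κ_ε and clause (ii) for every flip-steady family
  refine ⟨fun T => if hT : 0 < T then (key T hT).choose_spec.choose else 1, fun T hT => ?_,
    fun μ hμ T hT => ?_⟩
  · simp only [dif_pos hT]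
    exact (key T hT).choose_spec.choose_spec.1
  · obtain ⟨-, hD, hDk⟩ := (key T hT).choose_spec.choose_spec
    refine ⟨(key T hT).choose, fun N => ?_, ?_⟩
    · refine (hD N).congr' ?_
      have hball : Set.Ioo (-(2 * T)) (2 * T) ∈ 𝓝 (0 : ℝ) := Ioo_mem_nhds (by linarith) (by linarith)
      filter_upwards [mem_nhdsWithin_of_mem_nhds hball] with δ hδ
      have h1 : 0 < T + δ / 2 := by linarith [hδ.1]
      have h2 : 0 < T - δ / 2 := by linarith [hδ.2]
      rw [huniq N _ _ h1 h2 _ (hμ N _ _ h1 h2)]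
    · simp only [dif_pos hT]
      exact hDk

/-- **The skeleton concludes the crux BY NAME.** `NoisyFourier` (route `VanishingNoiseTransfer`,
stmt-AtomisticToContinuum-11977) from the five registered stubs (hypotheses keyed by stub name; no sorry
in this theorem). -/
theorem NoisyFourier_of (h1 : Registered.stub_nessExistsUnique) (h2 : Registered.stub_kuboThomson)
    (h3 : Registered.stub_sectorCoercivity) (h4 : Registered.stub_halfConservedWitness)
    (h5 : Registered.stub_responseConverges) :
    Summit.AtomisticToContinuum.FouriersLaw.Theses.VanishingNoiseTransfer.NoisyFourier :=
  noisyFourier_iff.mpr fun _ _ _ _ hω hl hβ hγ _ hε =>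
    flipFouriersLawFor_of_parts h1 h2 h3 h4 h5 hω hl hβ hγ hε

/-- Wiring check: the registered stubs feed `NoisyFourier_of` as stated. -/
example : Summit.AtomisticToContinuum.FouriersLaw.Theses.VanishingNoiseTransfer.NoisyFourier :=
  NoisyFourier_of stub_nessExistsUnique stub_kuboThomson stub_sectorCoercivity stub_halfConservedWitness
    stub_responseConverges

end Summit.AtomisticToContinuum.FouriersLaw.Cruxes.NoisyFourier.HalfConservedWitness

end
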